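import Summits.BirchSwinnertonDyer.BirchSwinnertonDyer.Theorems.EisensteinPrimesBSDpOnCellCTelescopeKernel
import Summits.BirchSwinnertonDyer.BirchSwinnertonDyer.Theorems.EisensteinPrimesBSDpOnCellCOfNamedFactsV14
import Summits.BirchSwinnertonDyer.BirchSwinnertonDyer.Theorems.SignedBaseChangeAnticyclotomicEisensteinDivisibilitySpecializationHerbrand
import HarnessLib

/-!
# Line «telescope» — K2 SPLIT PATCH, REBASED ON THE LEAD's v3 (ideator bsd-idea-12 g29 → LEAD cruxlead-19034 g1; adopt / edit / discard)

NOT A SKELETON; never `skeleton check`ed (W-79). Self-contained, farm-checked patch against the LEAD's telescope v3 candidate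
(`HOME/cruxlead-19034-g1/BSDpOnCellC.telescope-v3.lean` sha256 362e3966…, six stubs, AN/ALG cut of the carrier). It splits v3's research stub
`stub_carrierAlg` (∀ analytic package → ∃ F, (nondeg), (alg∞), ∀ k ∃ Φ_k ≡ F·G_k (mod X − x_k) with the element-level control (alg_k)) into

  * `stub_carrierAlgW`      (RESEARCH, XL — v3's residual named at MODULE level): ∀ analytic package → ∃ F AND a finitely generated `R₀⟦X⟧⟦T⟧`-module
    `𝒩` with `charIdeal 𝒩 = (F)`, (nondeg), (alg∞) VERBATIM, and ∀ k: a regularity element `s_k ∉ (X − x_k)` killing `𝒩` and the one-sided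
    control (ctrl_k) «`p^j · char(𝔛_{𝔭bar}(g_k)) · 𝓞_{ℂ_p}⟦T⟧ ≤ char_{R₀⟦T⟧}(𝒩/(X − x_k)𝒩) · 𝓞_{ℂ_p}⟦T⟧`» (cokernel half; Ochiai 2006 §5: holds without (Ir)
    in the cyclotomic analogue) — no `Φ_k`, no remainder clause;
  * `stub_herbrandTranslate` (BENCH, M, PURE COMMUTATIVE ALGEBRA, true as stated; unchanged from the v1-based patch `Lines/telescopeK2split.lean`):
    one-sided Herbrand «`charIdeal A (N/πN) ≤ (charIdeal B N).map φ`» along a retraction `φ : B →+* A` with kernel `(π)`, `N` killed by some `s ∉ (π)`;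

and proves SORRY-FREE `carrierAlg_of_witness : CarrierAlgWStatement → HerbrandTranslateStatement → CarrierAlgStatement` (`CarrierAlgStatement` :=
v3's `stub_carrierAlg` text token-for-token), `stub_carrierAlg_of_K2split`, and the SPLICE CERTIFICATE `example : <raw v3 text of stub_carrierAlg> :=
carrierAlg_of_witness stub_carrierAlgW stub_herbrandTranslate` — so in v3's one-line composition the argument `stub_carrierAlg` may be replaced by
`(carrierAlg_of_witness stub_carrierAlgW stub_herbrandTranslate)` (inside `TelescopeCarrierSplit.carrier_of_an_of_alg stub_carrierAn …`). Kernel =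
coefficientwise evaluation `evInner` of the INNER variable at `x_k ∈ 𝔪` (x2-p2's `AccumHelpers.evAt`), kernel `(C (X − C x_k))`, factoriality of
`R₀⟦T⟧` / `R₀⟦X⟧⟦T⟧` from tree theorems, `Φ_k := F(x_k, T)`, `G_k := 1`.

SPLICE for v3 → v3' (seven stubs) or a later v4: add ONE import (`…Theorems.SignedBaseChangeAnticyclotomicEisensteinDivisibilitySpecializationHerbrand`);
replace `stub_carrierAlg` by §S' below; add §D + §K2; composition argument as above. RESTUB tokens: carrierAlgW CONTENT (research XL; promote-stub
candidate) · herbrandTranslate CONTENT → «p9 bench: stub_herbrandTranslate (M, pure algebra)». No objection to the AN/ALG cut itself (the q-expansion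
chart pins every member to the branch through `f_E`; (ctrl_k)/(alg_k) are invariant under analytic re-parametrisation of the disc).

HONESTY: BSD is proved for no curve; nothing here proves the crux, a stub of record, or any summit statement; the two stubs are `sorry` and
`stub_carrierAlg_of_K2split` is conditional on them. `lean check`: sorries ONLY in the two `stub_*`; `#print axioms carrierAlg_of_witness` standard.
-/

set_option autoImplicit false
set_option linter.dupNamespace false

noncomputable section

open scoped Classical MatrixGroups ModularForm

open CongruenceSubgroup WeierstrassCurve NumberField IsDedekindDomain Field PowerSeries
  Literature.NumberTheory.EllipticCurves Literature.NumberTheory.EllipticCurves.GreenbergSelmer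
  Literature.NumberTheory.EllipticCurves.ModularForms Literature.NumberTheory.QuadraticFields
  Literature.NumberTheory.EllipticCurves.Rank1Residual
  Literature.NumberTheory.EllipticCurves.Rank1Residual.Typed
  Literature.NumberTheory.EllipticCurves.KrizLi2019
  Literature.NumberTheory.EllipticCurves.GreenbergVatsal2000
  Literature.NumberTheory.EllipticCurves.Wuthrich2014
  Literature.NumberTheory.EllipticCurves.SteinWuthrich2013
  Literature.NumberTheory.EllipticCurves.Castella2018Exceptional
  Literature.NumberTheory.GaloisRepresentations Literature.NumberTheory.GaloisCohomology
  Literature.NumberTheory.Automorphic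
  Summit.BirchSwinnertonDyer.Rank1Residual.X11b.AcSelmer
  Summit.BirchSwinnertonDyer.Rank1Residual.X11b.Halves
  Summit.BirchSwinnertonDyer.Rank1Residual.X11b
  Summit.BirchSwinnertonDyer.Rank1Residual Summit.BirchSwinnertonDyer.Rank1Residual.X1
  Summit.BirchSwinnertonDyer.Rank1Residual.X2
open Literature.NumberTheory.EllipticCurves.KellerYin2024 (curveLocalLambda)


open Literature.NumberTheory.EllipticCurves.BigGaloisRep

namespace Summit.BirchSwinnertonDyer.BirchSwinnertonDyer.Cruxes.BSDpOnCellC.Telescope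

open Literature.NumberTheory.EllipticCurves.CastellaGrossiLeeSkinner2022 Literature.NumberTheory.EllipticCurves.Castella2018
  Literature.NumberTheory.IwasawaTheory Literature.NumberTheory.IwasawaTheory.Greenberg2016
  Literature.NumberTheory.IwasawaTheory.Greenberg2006
  Summit.BirchSwinnertonDyer.Rank1Residual.X1.KellerYinMuLambdaSplit
open Literature.NumberTheory.EllipticCurves.KellerYin2024
open Summit.BirchSwinnertonDyer.BirchSwinnertonDyer.Theorems

/-! ## §S' The two stubs replacing v3's `stub_carrierAlg` (K2-W research at module level, K2-H bench) -/

/-- **stub_carrierAlgW** [K2-W rebased on v3: the MODULE-LEVEL form of v3's `stub_carrierAlg`; RESEARCH, size XL — the research residual of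
crux 4's road-R-β half, now WITHOUT the Herbrand algebra]. Under road R-β's binders, for every analytic package `(L, x, D)` of `stub_carrierAn`
(all its clauses as hypotheses, chart included): `∃ F ∈ R₀⟦X⟧⟦T⟧` and a finitely generated `R₀⟦X⟧⟦T⟧`-module `𝒩` (an `R₀⟦T⟧`-module through
`PowerSeries.C`) with `char_{R₀⟦X⟧⟦T⟧}(𝒩) = (F)`, (nondeg) `X ∤ F`, (alg∞) VERBATIM, and for every `k`: a REGULARITY element `s_k ∉ (X − x_k)` with
`s_k·𝒩 = 0` (⟺ the member fibre `𝒩/(X − x_k)𝒩` is `R₀⟦T⟧`-torsion ⟺ `(X − x_k) ∤ F`; arranged by the witness off the finitely many bad fibres) and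
the one-sided CONTROL (ctrl_k) `p^j·char(𝔛_{𝔭bar}(g_k))·𝓞_{ℂ_p}⟦T⟧ ≤ char_{R₀⟦T⟧}(𝒩/(X − x_k)𝒩)·𝓞_{ℂ_p}⟦T⟧` for every reading map `b` — the
COKERNEL half of control («the fibre has at most the torsion of `𝔛(g_k)` up to `p^j`»), stated where the printed control theorems live. INTENDED
WITNESS: `𝒩 :=` (the push-forward to `R₀` along the chart of) `H̃²(C₂)`, Nekovář's Selmer complex of the free rank-2 branch lattice with DEGENERATE
Greenberg data (card `Lines/telescope.md` § K2 PROOF PLAN: N1 exact control in the weight direction for a FREE lattice gives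
`𝒩/(X − x_k) ↪ H̃²(C_{x_k})` with cokernel `H̃³[X − x_k]`; N3/N4 compare `H̃²(C_{x_k})` with the member's `XBig … 𝔭bar ∅` up to `p`-power × pseudo-null).
Why it might fail: exactly v3's `stub_carrierAlg` clause — two-variable control INCLUSIONS at a residually REDUCIBLE, non-Gorenstein Eisenstein
point `p ‖ N` are unprinted (the typed print facts `ochiai2006_lemma72_cor75` / `Delbourgo2008.VerticalDatum.thm1011_constantCoeff_char₂` carry
`HasIrreducibleModPGaloisRep` / `IsIsolated` binders undischargeable on Cell C); a non-pseudo-null error term in (alg∞); a `(X − x_k)`-torsion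
pseudo-null submodule of positive `Λ`-rank at infinitely many member fibres. The Herbrand step v3 bundled into (alg_k) is NOT here: it is
`stub_herbrandTranslate`, and `carrierAlg_of_witness` recombines the two.]
[cite: Nekovar2006, §7.8 Thm. 7.8.6, §8.9, §9.6 Lemma 9.6.3 / Prop. 9.6.6, Prop. 12.7.13.4 (Selmer Complexes, Astérisque 310) (shape only)]
[cite: Ochiai2006, §5 Prop. 5.1 and Lemma 7.2 (Compositio Math. 142 pp. 1177, 1187–1189)]
[cite: Delbourgo2008, Thm. 7.15, Prop. 10.10, Thm. 10.11, App. C Thm. C.15 (LMS Lecture Note Ser. 356)]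
[cite: Howard2007, Thm. 3 (Invent. Math. 167)] [cite: CastellaWan2016, §§3–4 (arXiv:1607.02019) (shape only)] -/
theorem stub_carrierAlgW :
    ∀ (W : WeierstrassCurve ℚ) [W.IsElliptic] [W.IsGloballyMinimal] (p : ℕ) [Fact p.Prime],
    ∀ (N : ℕ) [NeZero N] (K : Type) [Field K] [NumberField K] (Dt : ModularParametrizationData W N)
      (H : HeegnerDatum N (NumberField.discr K)) (ιK : K →+* ℂ) (P : (W.baseChange K).toAffine.Point),
      CellC W p → W.conductorNorm ℤ = N →
      IsImaginaryQuadratic K → NumberField.discr K < -4 → SatisfiesHeegnerHypothesis N K →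
      (W.quadraticTwist (NumberField.discr K : ℚ)).entireLFunction 1 ≠ 0 →
      WeierstrassCurve.Affine.Point.map ιK.toRatAlgHom P = heegnerPointComplex Dt H →
      ¬ (p : ℤ) ∣ Dt.c → ¬ IsOfFinAddOrder P →
      Odd (NumberField.discr K) →
      ∀ (κ : ZpExtension K p), κ.IsAnticyclotomic →
        ∀ (γ : Field.absoluteGaloisGroup K) [Fact (κ.IsTopGenerator γ)]
          (𝔭 : HeightOneSpectrum (𝓞 K)), ((p : ℕ) : 𝓞 K) ∈ 𝔭.asIdeal →
          𝔭.asIdeal.ramificationIdx (𝓞 ℚ) = 1 → 𝔭.asIdeal.inertiaDeg (𝓞 ℚ) = 1 →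
          ∀ (𝔭bar : HeightOneSpectrum (𝓞 K)), ((p : ℕ) : 𝓞 K) ∈ 𝔭bar.asIdeal → 𝔭bar ≠ 𝔭 →
            ((Ideal.span {(p : ℤ)}).primesOver (𝓞 K)).ncard = 2 →
          ∀ (f : CuspForm (CongruenceSubgroup.Gamma0 N) 2), IsNewformOf W f →
            ∀ (ι' : PadicAlgCl p ≃+* ℂ),
              (∀ (w : InfinitePlace K) (k : 𝓞 K),
                k ∈ 𝔭.asIdeal ↔ ‖ι'.symm (w.embedding (k : K))‖ < 1) →
              ∀ (ΩK : ℂ) (Ωp : ℂ_[p]) (Q : PowerSeries 𝓞_ℂ_[p]), ΩK ≠ 0 → ‖Ωp‖ = 1 →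
                R1.IsBDPLFunctionInt p ι' 𝔭 κ γ f ΩK Ωp Q →
      ∀ (L : PowerSeries (PowerSeries (unrIntegers p))) (x : ℕ → ℤ_[p]) (D : ℕ → Skinner2016.HidaCongruentForm W p 1),
        (∀ k, ‖x k‖ < 1) ∧ Filter.Tendsto x Filter.atTop (nhds 0) ∧
        (∃ e : ℕ, PowerSeries.C ((p : 𝓞_ℂ_[p]) ^ e) * Q ∈
          Ideal.span {PowerSeries.map (R1.unrToCpInt p) (PowerSeries.map (PowerSeries.constantCoeff (R := unrIntegers p)) L)}) ∧
        (∀ k : ℕ, (∀ y : coeffField (D k).g, ι' ((D k).ι y) = (y : ℂ)) ∧ 2 * ((p : ℤ) - 1) ∣ (D k).k - 2 ∧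
          ∃ (ΩKg : ℂ) (Ωpg : ℂ_[p]) (Lg : UnrSeries p), ΩKg ≠ 0 ∧ ‖Ωpg‖ = 1 ∧
            IsBDPLFunctionWt ι' 𝔭 κ γ (D k).g ΩKg Ωpg Lg ∧
          ∃ Ψ : UnrSeries p,
            (∃ U : PowerSeries (PowerSeries (unrIntegers p)),
              PowerSeries.map (PowerSeries.C (R := unrIntegers p)) Ψ =
                L + PowerSeries.C (PowerSeries.X - PowerSeries.C (toUnr p (x k))) * U) ∧
            (∃ e : ℕ, PowerSeries.C ((p : 𝓞_ℂ_[p]) ^ e) * PowerSeries.map (R1.unrToCpInt p) Ψ ∈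
              Ideal.span {PowerSeries.map (R1.unrToCpInt p) Lg})) ∧
        (∃ A : ℕ → UnrSeries p, ∀ ℓ : ℕ, ℓ.Prime → ¬ ℓ ∣ N →
          (∃ U : UnrSeries p, A ℓ = PowerSeries.C (toUnr p ((W.frobeniusTrace ℓ : ℤ) : ℤ_[p])) + PowerSeries.X * U) ∧
          ∀ k : ℕ, ∃ (c : unrIntegers p) (U : UnrSeries p),
            A ℓ = PowerSeries.C c + (PowerSeries.X - PowerSeries.C (toUnr p (x k))) * U ∧
            ((c : ℂ_[p]) = algebraMap (PadicAlgCl p) ℂ_[p]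
              ((D k).ι ⟨(UpperHalfPlane.qExpansion 1 ⇑(D k).g).coeff ℓ, coeff_mem_coeffField (D k).g ℓ⟩))) →
      ∃ (F : PowerSeries (PowerSeries (unrIntegers p)))
        (𝒩 : Type) (_ : AddCommGroup 𝒩) (_ : Module (PowerSeries (PowerSeries (unrIntegers p))) 𝒩)
        (_ : Module (PowerSeries (unrIntegers p)) 𝒩)
        (_ : IsScalarTower (PowerSeries (unrIntegers p)) (PowerSeries (PowerSeries (unrIntegers p))) 𝒩)
        (_ : Module.Finite (PowerSeries (PowerSeries (unrIntegers p))) 𝒩),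
        Literature.NumberTheory.EllipticCurves.Module.charIdeal (PowerSeries (PowerSeries (unrIntegers p))) 𝒩 =
          Ideal.span {F} ∧
        ¬ (PowerSeries.C (PowerSeries.X : PowerSeries (unrIntegers p)) ∣ F) ∧
        (∃ j : ℕ, PowerSeries.C ((p : 𝓞_ℂ_[p]) ^ j) *
            PowerSeries.map (R1.unrToCpInt p) (PowerSeries.map (PowerSeries.constantCoeff (R := unrIntegers p)) F) ∈
          (XAc.charIdeal (W.baseChange K) p κ 𝔭bar ∅ γ).map (PowerSeries.map (R1.toCpInt p))) ∧
        ∀ k : ℕ,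
          (∃ s : PowerSeries (PowerSeries (unrIntegers p)),
            ¬ (PowerSeries.C (PowerSeries.X - PowerSeries.C (toUnr p (x k))) ∣ s) ∧ ∀ m : 𝒩, s • m = 0) ∧
          ∀ (b : padicCoeffIntegers (D k).ι →+* 𝓞_ℂ_[p]),
            (∀ y, ((b y : 𝓞_ℂ_[p]) : ℂ_[p]) =
              algebraMap (PadicAlgCl p) ℂ_[p] (padicCoeffIntegers.toPadicAlgCl (D k).ι y)) →
          ∀ [TopologicalSpace (PowerSeries (padicCoeffIntegers (D k).ι))]
            [ContinuousSMul (PowerSeries (padicCoeffIntegers (D k).ι))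
              (BigRepModule (padicCoeffIntegers (D k).ι) p (Cofree (D k).Δ.selfDualRep (padicCoeffField (D k).ι)))],
            ∃ j : ℕ, Ideal.span {PowerSeries.C ((p : 𝓞_ℂ_[p]) ^ j)} *
                (XBig.charIdeal κ ((D k).Δ.selfDualCofreeRepOver K) 𝔭bar
                  (∅ : Set (HeightOneSpectrum (𝓞 K)))).map (PowerSeries.map b) ≤
              (Literature.NumberTheory.EllipticCurves.Module.charIdeal (PowerSeries (unrIntegers p))
                  (QuotSMulTop (PowerSeries.C (PowerSeries.X - PowerSeries.C (toUnr p (x k)))) 𝒩)).map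
                (PowerSeries.map (R1.unrToCpInt p)) := by
  sorry

/-- **stub_herbrandTranslate** [K2-H of crux idea «telescope» (v2), PURE COMMUTATIVE ALGEBRA, bench-grade (M)]: ONE-SIDED HERBRAND /
EULER-CHARACTERISTIC SPECIALISATION of characteristic ideals along a RETRACTION. Data: Noetherian factorial domains `A → B` (`Algebra A B`)
with a ring retraction `φ : B →+* A` (`φ ∘ algebraMap = id`) whose kernel is `(π)` (`φ π = 0`, `φ b = 0 → π ∣ b`); a finite `B`-module
`N` (an `A`-module by `IsScalarTower`) killed by some `s ∉ (π)`. Conclusion: `char_A(N/πN) ⊆ φ(char_B N)·A` (`charIdeal` = the tree's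
generic `Literature.NumberTheory.EllipticCurves.Module.charIdeal`; `N/πN = QuotSMulTop π N`). Instance used in §K2: `A = R₀⟦T⟧`,
`B = R₀⟦X⟧⟦T⟧`, `π = X - x_k` (a constant in the inner variable), `φ = evInner` (coefficientwise evaluation `X ↦ x_k`).
Proof sketch (standard): `s ∈ Ann N`, `π ∤ s` ⇒ `N` is `B`-torsion with no height-one support at `(π)`, so `f := gen(char_B N)` has
`φ f ≠ 0`, and `N/πN` is a finite torsion `A`-module (killed by `φ s ≠ 0`); localise at a height-one prime `𝔮 ⊂ A`, `Q := φ⁻¹𝔮` (height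
2; `B_Q` is regular local of dimension 2 since `B_Q/π = A_𝔮` is a DVR); the Euler characteristic `e(M) := ℓ_{A_𝔮}(M/πM) − ℓ_{A_𝔮}(M[π])`
is additive in short exact sequences of finite torsion `B_Q`-modules killed by an element prime to `π` (snake lemma), vanishes on modules
of finite length, and equals `ord_𝔮(φ g)` on `B_Q/(g)` (`π ∤ g` ⇒ `M[π] = 0`); a prime filtration of `N_Q` gives `e(N_Q) = ord_𝔮(φ f)`,
whence `ℓ_𝔮(N/πN) ≥ ord_𝔮(φ f)` for every `𝔮`, i.e. the claim (`A` factorial: `(φ f) = ∏ 𝔮^{ord_𝔮(φ f)}`). The OPPOSITE inclusion is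
false in general (pseudo-null `B`-modules such as `B/(p, π)` contribute `(p)` to the fibre and `(1)` to `φ(char_B)`), which is why the
witness states member control one-sidedly. Generalises the tree's `PowerSeriesSpecialization.charIdeal_quotSMulTop_eq_mul` and
`PrintCf2.LinePushOneSided.charIdeal_quotSMulTop_le_map_constantCoeff` (the case `B = A⟦X⟧`, `π = X`, `φ = constantCoeff`; two-sided
engine `Literature…IwasawaAlgebra.charIdeal_eq_mul_of_exact`). Sources: Delbourgo, *Elliptic Curves and Big Galois Representations*
(2008) Lemma 10.5 (leading-term formula `𝔆_M(Y)|_{Y=0} = char_R(coker α)/char_R(ker α)`, `α : M[Y] → M/YM` — its torsion case is the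
two-sided Herbrand identity of which this stub is the «⊆» half); Ochiai, Compos. Math. 142 (2006) Lemma 7.2 (specialisation of
characteristic ideals modulo height-one primes, the pseudo-null obstruction `(Sel^∨)_null/J`); Skinner–Urban 2014 Cor. 3.2.9 (as cited by
the tree's `charIdeal_quotSMulTop_eq_mul`); Bourbaki AC VII §4.4–4.5.
Why it might fail: only by mis-typing — the junk values of the generic `charIdeal` (`⊤` on non-torsion modules, `ENat.toNat ⊤ = 0`) are
excluded on BOTH sides by the `s`-hypothesis; the degenerate case `π = 0` (`φ` an isomorphism) holds by transport of structure. -/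
theorem stub_herbrandTranslate :
    ∀ (A B : Type) [CommRing A] [CommRing B] [IsDomain A] [IsDomain B] [IsNoetherianRing A] [IsNoetherianRing B]
      [UniqueFactorizationMonoid A] [UniqueFactorizationMonoid B] [Algebra A B]
      (π : B) (φ : B →+* A),
      (∀ a : A, φ (algebraMap A B a) = a) → φ π = 0 → (∀ b : B, φ b = 0 → π ∣ b) →
    ∀ (N : Type) [AddCommGroup N] [Module B N] [Module A N] [IsScalarTower A B N] [Module.Finite B N],
      (∃ s : B, ¬ π ∣ s ∧ ∀ m : N, s • m = 0) →
      Literature.NumberTheory.EllipticCurves.Module.charIdeal A (QuotSMulTop π N) ≤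
        (Literature.NumberTheory.EllipticCurves.Module.charIdeal B N).map φ
    := by
  sorry


/-! ## §D The statements as named `Prop`s -/

/-- v3's `stub_carrierAlg` (LEAD cruxlead-19034 g1, mirror sha256 362e3966…), token-identical, as a named `Prop`. -/
def CarrierAlgStatement : Prop :=
    ∀ (W : WeierstrassCurve ℚ) [W.IsElliptic] [W.IsGloballyMinimal] (p : ℕ) [Fact p.Prime],
    ∀ (N : ℕ) [NeZero N] (K : Type) [Field K] [NumberField K] (Dt : ModularParametrizationData W N)
      (H : HeegnerDatum N (NumberField.discr K)) (ιK : K →+* ℂ) (P : (W.baseChange K).toAffine.Point),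
      CellC W p → W.conductorNorm ℤ = N →
      IsImaginaryQuadratic K → NumberField.discr K < -4 → SatisfiesHeegnerHypothesis N K →
      (W.quadraticTwist (NumberField.discr K : ℚ)).entireLFunction 1 ≠ 0 →
      WeierstrassCurve.Affine.Point.map ιK.toRatAlgHom P = heegnerPointComplex Dt H →
      ¬ (p : ℤ) ∣ Dt.c → ¬ IsOfFinAddOrder P →
      Odd (NumberField.discr K) →
      ∀ (κ : ZpExtension K p), κ.IsAnticyclotomic →
        ∀ (γ : Field.absoluteGaloisGroup K) [Fact (κ.IsTopGenerator γ)]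
          (𝔭 : HeightOneSpectrum (𝓞 K)), ((p : ℕ) : 𝓞 K) ∈ 𝔭.asIdeal →
          𝔭.asIdeal.ramificationIdx (𝓞 ℚ) = 1 → 𝔭.asIdeal.inertiaDeg (𝓞 ℚ) = 1 →
          ∀ (𝔭bar : HeightOneSpectrum (𝓞 K)), ((p : ℕ) : 𝓞 K) ∈ 𝔭bar.asIdeal → 𝔭bar ≠ 𝔭 →
            ((Ideal.span {(p : ℤ)}).primesOver (𝓞 K)).ncard = 2 →
          ∀ (f : CuspForm (CongruenceSubgroup.Gamma0 N) 2), IsNewformOf W f →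
            ∀ (ι' : PadicAlgCl p ≃+* ℂ),
              (∀ (w : InfinitePlace K) (k : 𝓞 K),
                k ∈ 𝔭.asIdeal ↔ ‖ι'.symm (w.embedding (k : K))‖ < 1) →
              ∀ (ΩK : ℂ) (Ωp : ℂ_[p]) (Q : PowerSeries 𝓞_ℂ_[p]), ΩK ≠ 0 → ‖Ωp‖ = 1 →
                R1.IsBDPLFunctionInt p ι' 𝔭 κ γ f ΩK Ωp Q →
      ∀ (L : PowerSeries (PowerSeries (unrIntegers p))) (x : ℕ → ℤ_[p]) (D : ℕ → Skinner2016.HidaCongruentForm W p 1),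
        (∀ k, ‖x k‖ < 1) ∧ Filter.Tendsto x Filter.atTop (nhds 0) ∧
        (∃ e : ℕ, PowerSeries.C ((p : 𝓞_ℂ_[p]) ^ e) * Q ∈
          Ideal.span {PowerSeries.map (R1.unrToCpInt p) (PowerSeries.map (PowerSeries.constantCoeff (R := unrIntegers p)) L)}) ∧
        (∀ k : ℕ, (∀ y : coeffField (D k).g, ι' ((D k).ι y) = (y : ℂ)) ∧ 2 * ((p : ℤ) - 1) ∣ (D k).k - 2 ∧
          ∃ (ΩKg : ℂ) (Ωpg : ℂ_[p]) (Lg : UnrSeries p), ΩKg ≠ 0 ∧ ‖Ωpg‖ = 1 ∧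
            IsBDPLFunctionWt ι' 𝔭 κ γ (D k).g ΩKg Ωpg Lg ∧
          ∃ Ψ : UnrSeries p,
            (∃ U : PowerSeries (PowerSeries (unrIntegers p)),
              PowerSeries.map (PowerSeries.C (R := unrIntegers p)) Ψ =
                L + PowerSeries.C (PowerSeries.X - PowerSeries.C (toUnr p (x k))) * U) ∧
            (∃ e : ℕ, PowerSeries.C ((p : 𝓞_ℂ_[p]) ^ e) * PowerSeries.map (R1.unrToCpInt p) Ψ ∈
              Ideal.span {PowerSeries.map (R1.unrToCpInt p) Lg})) ∧
        (∃ A : ℕ → UnrSeries p, ∀ ℓ : ℕ, ℓ.Prime → ¬ ℓ ∣ N →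
          (∃ U : UnrSeries p, A ℓ = PowerSeries.C (toUnr p ((W.frobeniusTrace ℓ : ℤ) : ℤ_[p])) + PowerSeries.X * U) ∧
          ∀ k : ℕ, ∃ (c : unrIntegers p) (U : UnrSeries p),
            A ℓ = PowerSeries.C c + (PowerSeries.X - PowerSeries.C (toUnr p (x k))) * U ∧
            ((c : ℂ_[p]) = algebraMap (PadicAlgCl p) ℂ_[p]
              ((D k).ι ⟨(UpperHalfPlane.qExpansion 1 ⇑(D k).g).coeff ℓ, coeff_mem_coeffField (D k).g ℓ⟩))) →
      ∃ F : PowerSeries (PowerSeries (unrIntegers p)),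
        ¬ (PowerSeries.C (PowerSeries.X : PowerSeries (unrIntegers p)) ∣ F) ∧
        (∃ j : ℕ, PowerSeries.C ((p : 𝓞_ℂ_[p]) ^ j) *
            PowerSeries.map (R1.unrToCpInt p) (PowerSeries.map (PowerSeries.constantCoeff (R := unrIntegers p)) F) ∈
          (XAc.charIdeal (W.baseChange K) p κ 𝔭bar ∅ γ).map (PowerSeries.map (R1.toCpInt p))) ∧
        ∀ k : ℕ, ∃ Φ : UnrSeries p,
          (∃ G U : PowerSeries (PowerSeries (unrIntegers p)),
            PowerSeries.map (PowerSeries.C (R := unrIntegers p)) Φ =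
              F * G + PowerSeries.C (PowerSeries.X - PowerSeries.C (toUnr p (x k))) * U) ∧
          ∀ (b : padicCoeffIntegers (D k).ι →+* 𝓞_ℂ_[p]),
            (∀ y, ((b y : 𝓞_ℂ_[p]) : ℂ_[p]) =
              algebraMap (PadicAlgCl p) ℂ_[p] (padicCoeffIntegers.toPadicAlgCl (D k).ι y)) →
          ∀ [TopologicalSpace (PowerSeries (padicCoeffIntegers (D k).ι))]
            [ContinuousSMul (PowerSeries (padicCoeffIntegers (D k).ι))
              (BigRepModule (padicCoeffIntegers (D k).ι) p (Cofree (D k).Δ.selfDualRep (padicCoeffField (D k).ι)))],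
            ∃ j : ℕ, Ideal.span {PowerSeries.C ((p : 𝓞_ℂ_[p]) ^ j)} *
                (XBig.charIdeal κ ((D k).Δ.selfDualCofreeRepOver K) 𝔭bar
                  (∅ : Set (HeightOneSpectrum (𝓞 K)))).map (PowerSeries.map b) ≤
              Ideal.span {PowerSeries.map (R1.unrToCpInt p) Φ}

/-- The statement of `stub_carrierAlgW` as a named `Prop` (K2-W, module level). -/
def CarrierAlgWStatement : Prop :=
    ∀ (W : WeierstrassCurve ℚ) [W.IsElliptic] [W.IsGloballyMinimal] (p : ℕ) [Fact p.Prime],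
    ∀ (N : ℕ) [NeZero N] (K : Type) [Field K] [NumberField K] (Dt : ModularParametrizationData W N)
      (H : HeegnerDatum N (NumberField.discr K)) (ιK : K →+* ℂ) (P : (W.baseChange K).toAffine.Point),
      CellC W p → W.conductorNorm ℤ = N →
      IsImaginaryQuadratic K → NumberField.discr K < -4 → SatisfiesHeegnerHypothesis N K →
      (W.quadraticTwist (NumberField.discr K : ℚ)).entireLFunction 1 ≠ 0 →
      WeierstrassCurve.Affine.Point.map ιK.toRatAlgHom P = heegnerPointComplex Dt H →
      ¬ (p : ℤ) ∣ Dt.c → ¬ IsOfFinAddOrder P →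
      Odd (NumberField.discr K) →
      ∀ (κ : ZpExtension K p), κ.IsAnticyclotomic →
        ∀ (γ : Field.absoluteGaloisGroup K) [Fact (κ.IsTopGenerator γ)]
          (𝔭 : HeightOneSpectrum (𝓞 K)), ((p : ℕ) : 𝓞 K) ∈ 𝔭.asIdeal →
          𝔭.asIdeal.ramificationIdx (𝓞 ℚ) = 1 → 𝔭.asIdeal.inertiaDeg (𝓞 ℚ) = 1 →
          ∀ (𝔭bar : HeightOneSpectrum (𝓞 K)), ((p : ℕ) : 𝓞 K) ∈ 𝔭bar.asIdeal → 𝔭bar ≠ 𝔭 →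
            ((Ideal.span {(p : ℤ)}).primesOver (𝓞 K)).ncard = 2 →
          ∀ (f : CuspForm (CongruenceSubgroup.Gamma0 N) 2), IsNewformOf W f →
            ∀ (ι' : PadicAlgCl p ≃+* ℂ),
              (∀ (w : InfinitePlace K) (k : 𝓞 K),
                k ∈ 𝔭.asIdeal ↔ ‖ι'.symm (w.embedding (k : K))‖ < 1) →
              ∀ (ΩK : ℂ) (Ωp : ℂ_[p]) (Q : PowerSeries 𝓞_ℂ_[p]), ΩK ≠ 0 → ‖Ωp‖ = 1 →
                R1.IsBDPLFunctionInt p ι' 𝔭 κ γ f ΩK Ωp Q →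
      ∀ (L : PowerSeries (PowerSeries (unrIntegers p))) (x : ℕ → ℤ_[p]) (D : ℕ → Skinner2016.HidaCongruentForm W p 1),
        (∀ k, ‖x k‖ < 1) ∧ Filter.Tendsto x Filter.atTop (nhds 0) ∧
        (∃ e : ℕ, PowerSeries.C ((p : 𝓞_ℂ_[p]) ^ e) * Q ∈
          Ideal.span {PowerSeries.map (R1.unrToCpInt p) (PowerSeries.map (PowerSeries.constantCoeff (R := unrIntegers p)) L)}) ∧
        (∀ k : ℕ, (∀ y : coeffField (D k).g, ι' ((D k).ι y) = (y : ℂ)) ∧ 2 * ((p : ℤ) - 1) ∣ (D k).k - 2 ∧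
          ∃ (ΩKg : ℂ) (Ωpg : ℂ_[p]) (Lg : UnrSeries p), ΩKg ≠ 0 ∧ ‖Ωpg‖ = 1 ∧
            IsBDPLFunctionWt ι' 𝔭 κ γ (D k).g ΩKg Ωpg Lg ∧
          ∃ Ψ : UnrSeries p,
            (∃ U : PowerSeries (PowerSeries (unrIntegers p)),
              PowerSeries.map (PowerSeries.C (R := unrIntegers p)) Ψ =
                L + PowerSeries.C (PowerSeries.X - PowerSeries.C (toUnr p (x k))) * U) ∧
            (∃ e : ℕ, PowerSeries.C ((p : 𝓞_ℂ_[p]) ^ e) * PowerSeries.map (R1.unrToCpInt p) Ψ ∈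
              Ideal.span {PowerSeries.map (R1.unrToCpInt p) Lg})) ∧
        (∃ A : ℕ → UnrSeries p, ∀ ℓ : ℕ, ℓ.Prime → ¬ ℓ ∣ N →
          (∃ U : UnrSeries p, A ℓ = PowerSeries.C (toUnr p ((W.frobeniusTrace ℓ : ℤ) : ℤ_[p])) + PowerSeries.X * U) ∧
          ∀ k : ℕ, ∃ (c : unrIntegers p) (U : UnrSeries p),
            A ℓ = PowerSeries.C c + (PowerSeries.X - PowerSeries.C (toUnr p (x k))) * U ∧
            ((c : ℂ_[p]) = algebraMap (PadicAlgCl p) ℂ_[p]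
              ((D k).ι ⟨(UpperHalfPlane.qExpansion 1 ⇑(D k).g).coeff ℓ, coeff_mem_coeffField (D k).g ℓ⟩))) →
      ∃ (F : PowerSeries (PowerSeries (unrIntegers p)))
        (𝒩 : Type) (_ : AddCommGroup 𝒩) (_ : Module (PowerSeries (PowerSeries (unrIntegers p))) 𝒩)
        (_ : Module (PowerSeries (unrIntegers p)) 𝒩)
        (_ : IsScalarTower (PowerSeries (unrIntegers p)) (PowerSeries (PowerSeries (unrIntegers p))) 𝒩)
        (_ : Module.Finite (PowerSeries (PowerSeries (unrIntegers p))) 𝒩),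
        Literature.NumberTheory.EllipticCurves.Module.charIdeal (PowerSeries (PowerSeries (unrIntegers p))) 𝒩 =
          Ideal.span {F} ∧
        ¬ (PowerSeries.C (PowerSeries.X : PowerSeries (unrIntegers p)) ∣ F) ∧
        (∃ j : ℕ, PowerSeries.C ((p : 𝓞_ℂ_[p]) ^ j) *
            PowerSeries.map (R1.unrToCpInt p) (PowerSeries.map (PowerSeries.constantCoeff (R := unrIntegers p)) F) ∈
          (XAc.charIdeal (W.baseChange K) p κ 𝔭bar ∅ γ).map (PowerSeries.map (R1.toCpInt p))) ∧
        ∀ k : ℕ,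
          (∃ s : PowerSeries (PowerSeries (unrIntegers p)),
            ¬ (PowerSeries.C (PowerSeries.X - PowerSeries.C (toUnr p (x k))) ∣ s) ∧ ∀ m : 𝒩, s • m = 0) ∧
          ∀ (b : padicCoeffIntegers (D k).ι →+* 𝓞_ℂ_[p]),
            (∀ y, ((b y : 𝓞_ℂ_[p]) : ℂ_[p]) =
              algebraMap (PadicAlgCl p) ℂ_[p] (padicCoeffIntegers.toPadicAlgCl (D k).ι y)) →
          ∀ [TopologicalSpace (PowerSeries (padicCoeffIntegers (D k).ι))]
            [ContinuousSMul (PowerSeries (padicCoeffIntegers (D k).ι))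
              (BigRepModule (padicCoeffIntegers (D k).ι) p (Cofree (D k).Δ.selfDualRep (padicCoeffField (D k).ι)))],
            ∃ j : ℕ, Ideal.span {PowerSeries.C ((p : 𝓞_ℂ_[p]) ^ j)} *
                (XBig.charIdeal κ ((D k).Δ.selfDualCofreeRepOver K) 𝔭bar
                  (∅ : Set (HeightOneSpectrum (𝓞 K)))).map (PowerSeries.map b) ≤
              (Literature.NumberTheory.EllipticCurves.Module.charIdeal (PowerSeries (unrIntegers p))
                  (QuotSMulTop (PowerSeries.C (PowerSeries.X - PowerSeries.C (toUnr p (x k)))) 𝒩)).map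
                (PowerSeries.map (R1.unrToCpInt p))

/-- The statement of `stub_herbrandTranslate` as a named `Prop` (K2-H). -/
def HerbrandTranslateStatement : Prop :=
    ∀ (A B : Type) [CommRing A] [CommRing B] [IsDomain A] [IsDomain B] [IsNoetherianRing A] [IsNoetherianRing B]
      [UniqueFactorizationMonoid A] [UniqueFactorizationMonoid B] [Algebra A B]
      (π : B) (φ : B →+* A),
      (∀ a : A, φ (algebraMap A B a) = a) → φ π = 0 → (∀ b : B, φ b = 0 → π ∣ b) →
    ∀ (N : Type) [AddCommGroup N] [Module B N] [Module A N] [IsScalarTower A B N] [Module.Finite B N],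
      (∃ s : B, ¬ π ∣ s ∧ ∀ m : N, s • m = 0) →
      Literature.NumberTheory.EllipticCurves.Module.charIdeal A (QuotSMulTop π N) ≤
        (Literature.NumberTheory.EllipticCurves.Module.charIdeal B N).map φ

/-! ### Evaluating the inner (weight) variable at a point of the maximal ideal -/

section EvalInner

variable {𝒪 : Type*} [CommRing 𝒪] [IsLocalRing 𝒪] [IsAdicComplete (IsLocalRing.maximalIdeal 𝒪) 𝒪]

/-- coefficientwise evaluation of the INNER variable `X` at `a ∈ 𝔪`: `𝒪⟦X⟧⟦T⟧ →+* 𝒪⟦T⟧`. -/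
def evInner (a : 𝒪) (ha : a ∈ IsLocalRing.maximalIdeal 𝒪) :
    PowerSeries (PowerSeries 𝒪) →+* PowerSeries 𝒪 :=
  PowerSeries.map (AccumHelpers.evAt a ha).toRingHom


lemma evInner_map_C (a : 𝒪) (ha : a ∈ IsLocalRing.maximalIdeal 𝒪) (g : PowerSeries 𝒪) :
    evInner a ha (PowerSeries.map (PowerSeries.C (R := 𝒪)) g) = g := by
  ext n
  simp only [evInner, PowerSeries.coeff_map, RingHom.coe_coe, AlgHom.toRingHom_eq_coe]
  exact AccumHelpers.evAt_C a ha _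

lemma evInner_C (a : 𝒪) (ha : a ∈ IsLocalRing.maximalIdeal 𝒪) (g : PowerSeries 𝒪) :
    evInner a ha (PowerSeries.C g) = PowerSeries.C (AccumHelpers.evAt a ha g) := by
  simp only [evInner, PowerSeries.map_C]
  rfl

lemma evInner_pi (a : 𝒪) (ha : a ∈ IsLocalRing.maximalIdeal 𝒪) :
    evInner a ha (PowerSeries.C (PowerSeries.X - PowerSeries.C a)) = 0 := by
  rw [evInner_C, map_sub, AccumHelpers.evAt_X, AccumHelpers.evAt_C, sub_self, map_zero]

lemma C_dvd_of_evInner_eq_zero (a : 𝒪) (ha : a ∈ IsLocalRing.maximalIdeal 𝒪)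
    (G : PowerSeries (PowerSeries 𝒪)) (h : evInner a ha G = 0) :
    PowerSeries.C (PowerSeries.X - PowerSeries.C a) ∣ G := by
  have hc : ∀ i, (PowerSeries.X - PowerSeries.C a) ∣ PowerSeries.coeff i G := by
    intro i
    rw [← AccumHelpers.evAt_eq_zero_iff a ha]
    have := congrArg (PowerSeries.coeff i) h
    rw [evInner, PowerSeries.coeff_map, map_zero] at this
    exact this
  choose q hq using hc
  refine ⟨PowerSeries.mk q, PowerSeries.ext fun i => ?_⟩
  rw [PowerSeries.coeff_C_mul, PowerSeries.coeff_mk]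
  exact hq i

end EvalInner

/-- `R₀⟦T⟧` is factorial (regular local of dimension 2: Auslander–Buchsbaum), from tree theorems. -/
theorem uniqueFactorizationMonoid_unrSeries (p : ℕ) [Fact p.Prime] :
    UniqueFactorizationMonoid (PowerSeries (unrIntegers p)) := by
  haveI := HidaLimitAlgebra.isDiscreteValuationRing_unrIntegers (p := p)
  haveI := Literature.NumberTheory.GaloisRepresentations.NearlyOrdinaryPresentationCA.isRegularLocalRing_mvPowerSeries_dvr
    (unrIntegers p) 1
  exact Literature.AlgebraicGeometry.Resolution.uniqueFactorizationMonoid_of_isRegularLocalRing _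
    (IsRegularLocalRing.of_ringEquiv (MvPowerSeries.renameEquiv (unrIntegers p) finOneEquiv.symm).toRingEquiv.symm)

set_option maxHeartbeats 1600000 in
/-- **KERNEL K2 (rebased on v3).** v3's `stub_carrierAlg` from the module-level witness (K2-W) and the Herbrand brick (K2-H): per member `k`,
apply K2-H to the evaluation retraction `φ_k = evInner (x_k) : R₀⟦X⟧⟦T⟧ → R₀⟦T⟧` (kernel `(X − x_k)`), `π = X − x_k`, `N = 𝒩`; with
`char 𝒩 = (F)` this is `char(𝒩/(X − x_k)𝒩) ≤ (F(x_k, T))`; push along `unrToCpInt` and chain under (ctrl_k): that is (alg_k) with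
`Φ_k := F(x_k, T)`, `G_k := 1`, the remainder clause being the kernel property. Sorry-free. -/
theorem carrierAlg_of_witness (hW : CarrierAlgWStatement) (hHer : HerbrandTranslateStatement) :
    CarrierAlgStatement := by
  intro W _ _ p _ N _ K _ _ Dt H ιK P hC hN hK hdisc hHeeg hL1 hP hc hfin hodd κ hκ γ _ 𝔭 h𝔭 hram hdeg 𝔭bar
    h𝔭bar hne hsp f hf ι' hι' ΩK Ωp Q hΩK hΩp hQ L x D hpkg
  obtain ⟨F, 𝒩, _i1, _i2, _i3, _i4, _i5, hchar, hF, halg, hmem⟩ :=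
    hW W p N K Dt H ιK P hC hN hK hdisc hHeeg hL1 hP hc hfin hodd κ hκ γ 𝔭 h𝔭 hram hdeg 𝔭bar h𝔭bar hne
      hsp f hf ι' hι' ΩK Ωp Q hΩK hΩp hQ L x D hpkg
  have hxk : ∀ k, ‖x k‖ < 1 := hpkg.1
  -- the receptacle `R₀ = unrIntegers p`: a complete DVR with uniformiser `p`; `R₀⟦T⟧`, `R₀⟦X⟧⟦T⟧` factorial
  haveI := HidaLimitAlgebra.isDiscreteValuationRing_unrIntegers (p := p)
  haveI : IsAdicComplete (IsLocalRing.maximalIdeal (unrIntegers p)) (unrIntegers p) :=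
    CongruentShaFreeCutUnrSeriesWeierstrass.isAdicComplete_maximalIdeal
  haveI : UniqueFactorizationMonoid (PowerSeries (PowerSeries (unrIntegers p))) :=
    Literature.NumberTheory.IwasawaTheory.uniqueFactorizationMonoid_powerSeries_powerSeries (unrIntegers p)
  haveI : UniqueFactorizationMonoid (PowerSeries (unrIntegers p)) := uniqueFactorizationMonoid_unrSeries p
  have hirr : Irreducible ((p : ℕ) : unrIntegers p) := HidaLimitAlgebra.irreducible_natCast_p
  have hpmem : ((p : ℕ) : unrIntegers p) ∈ IsLocalRing.maximalIdeal (unrIntegers p) :=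
    (IsLocalRing.mem_maximalIdeal _).mpr hirr.not_isUnit
  have hpt : ∀ z : ℤ_[p], ‖z‖ < 1 → toUnr p z ∈ IsLocalRing.maximalIdeal (unrIntegers p) := by
    intro z hz
    obtain ⟨y, hy⟩ := (PadicInt.norm_lt_one_iff_dvd z).mp hz
    rw [hy, map_mul, map_natCast]
    exact Ideal.mul_mem_right _ _ hpmem
  refine ⟨F, hF, halg, fun k => ?_⟩
  obtain ⟨⟨s, hsπ, hs⟩, hctrl⟩ := hmem k
  have ha : toUnr p (x k) ∈ IsLocalRing.maximalIdeal (unrIntegers p) := hpt _ (hxk k)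
  -- the evaluation retraction `φ_k : R₀⟦X⟧⟦T⟧ → R₀⟦T⟧`, `X ↦ x_k` (inner variable), kernel `(X - x_k)`
  let φ : PowerSeries (PowerSeries (unrIntegers p)) →+* PowerSeries (unrIntegers p) := evInner (toUnr p (x k)) ha
  have hφC : ∀ g : PowerSeries (unrIntegers p),
      φ (algebraMap (PowerSeries (unrIntegers p)) (PowerSeries (PowerSeries (unrIntegers p))) g) = g :=
    fun g => evInner_map_C _ ha g
  have hφπ : φ (PowerSeries.C (PowerSeries.X - PowerSeries.C (toUnr p (x k)))) = 0 := evInner_pi _ ha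
  have hφker : ∀ b : PowerSeries (PowerSeries (unrIntegers p)), φ b = 0 →
      PowerSeries.C (PowerSeries.X - PowerSeries.C (toUnr p (x k))) ∣ b :=
    fun b hb => C_dvd_of_evInner_eq_zero _ ha b hb
  -- ONE-SIDED HERBRAND at the member fibre: `char_{R₀⟦T⟧}(𝒩 / (X - x_k)𝒩) ⊆ (F(x_k, T))`
  have hle := hHer (PowerSeries (unrIntegers p)) (PowerSeries (PowerSeries (unrIntegers p)))
    (PowerSeries.C (PowerSeries.X - PowerSeries.C (toUnr p (x k)))) φ hφC hφπ hφker 𝒩 ⟨s, hsπ, hs⟩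
  rw [hchar, Ideal.map_span, Set.image_singleton] at hle
  refine ⟨φ F, ?_, ?_⟩
  · -- the fibre `Φ_k := F(x_k, T)` as a remainder: `Φ_k ≡ F (mod X - x_k)`
    obtain ⟨U, hU⟩ := hφker (PowerSeries.map (PowerSeries.C (R := unrIntegers p)) (φ F) - F) (by
      rw [map_sub, sub_eq_zero]
      exact hφC (φ F))
    exact ⟨1, U, by rw [mul_one, ← hU]; ring⟩
  · intro b hb _ _
    obtain ⟨j, hj⟩ := hctrl b hb
    refine ⟨j, hj.trans ?_⟩
    have hle' := Ideal.map_mono (f := PowerSeries.map (R1.unrToCpInt p)) hle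
    rwa [Ideal.map_span, Set.image_singleton] at hle'

/-! ## §P The patch theorems: v3's stub from the two new stubs -/

/-- **v3's `stub_carrierAlg` FROM THE SPLIT** (conditional on the two sorried stubs; nothing is proved). -/
theorem stub_carrierAlg_of_K2split : CarrierAlgStatement :=
  carrierAlg_of_witness stub_carrierAlgW stub_herbrandTranslate

/-- SPLICE CERTIFICATE: the same term against the RAW text of v3's `stub_carrierAlg` (what binder 2 of
`TelescopeCarrierSplit.carrier_of_an_of_alg` expects). -/
example :
    ∀ (W : WeierstrassCurve ℚ) [W.IsElliptic] [W.IsGloballyMinimal] (p : ℕ) [Fact p.Prime],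
    ∀ (N : ℕ) [NeZero N] (K : Type) [Field K] [NumberField K] (Dt : ModularParametrizationData W N)
      (H : HeegnerDatum N (NumberField.discr K)) (ιK : K →+* ℂ) (P : (W.baseChange K).toAffine.Point),
      CellC W p → W.conductorNorm ℤ = N →
      IsImaginaryQuadratic K → NumberField.discr K < -4 → SatisfiesHeegnerHypothesis N K →
      (W.quadraticTwist (NumberField.discr K : ℚ)).entireLFunction 1 ≠ 0 →
      WeierstrassCurve.Affine.Point.map ιK.toRatAlgHom P = heegnerPointComplex Dt H →
      ¬ (p : ℤ) ∣ Dt.c → ¬ IsOfFinAddOrder P →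
      Odd (NumberField.discr K) →
      ∀ (κ : ZpExtension K p), κ.IsAnticyclotomic →
        ∀ (γ : Field.absoluteGaloisGroup K) [Fact (κ.IsTopGenerator γ)]
          (𝔭 : HeightOneSpectrum (𝓞 K)), ((p : ℕ) : 𝓞 K) ∈ 𝔭.asIdeal →
          𝔭.asIdeal.ramificationIdx (𝓞 ℚ) = 1 → 𝔭.asIdeal.inertiaDeg (𝓞 ℚ) = 1 →
          ∀ (𝔭bar : HeightOneSpectrum (𝓞 K)), ((p : ℕ) : 𝓞 K) ∈ 𝔭bar.asIdeal → 𝔭bar ≠ 𝔭 →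
            ((Ideal.span {(p : ℤ)}).primesOver (𝓞 K)).ncard = 2 →
          ∀ (f : CuspForm (CongruenceSubgroup.Gamma0 N) 2), IsNewformOf W f →
            ∀ (ι' : PadicAlgCl p ≃+* ℂ),
              (∀ (w : InfinitePlace K) (k : 𝓞 K),
                k ∈ 𝔭.asIdeal ↔ ‖ι'.symm (w.embedding (k : K))‖ < 1) →
              ∀ (ΩK : ℂ) (Ωp : ℂ_[p]) (Q : PowerSeries 𝓞_ℂ_[p]), ΩK ≠ 0 → ‖Ωp‖ = 1 →
                R1.IsBDPLFunctionInt p ι' 𝔭 κ γ f ΩK Ωp Q →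
      ∀ (L : PowerSeries (PowerSeries (unrIntegers p))) (x : ℕ → ℤ_[p]) (D : ℕ → Skinner2016.HidaCongruentForm W p 1),
        (∀ k, ‖x k‖ < 1) ∧ Filter.Tendsto x Filter.atTop (nhds 0) ∧
        (∃ e : ℕ, PowerSeries.C ((p : 𝓞_ℂ_[p]) ^ e) * Q ∈
          Ideal.span {PowerSeries.map (R1.unrToCpInt p) (PowerSeries.map (PowerSeries.constantCoeff (R := unrIntegers p)) L)}) ∧
        (∀ k : ℕ, (∀ y : coeffField (D k).g, ι' ((D k).ι y) = (y : ℂ)) ∧ 2 * ((p : ℤ) - 1) ∣ (D k).k - 2 ∧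
          ∃ (ΩKg : ℂ) (Ωpg : ℂ_[p]) (Lg : UnrSeries p), ΩKg ≠ 0 ∧ ‖Ωpg‖ = 1 ∧
            IsBDPLFunctionWt ι' 𝔭 κ γ (D k).g ΩKg Ωpg Lg ∧
          ∃ Ψ : UnrSeries p,
            (∃ U : PowerSeries (PowerSeries (unrIntegers p)),
              PowerSeries.map (PowerSeries.C (R := unrIntegers p)) Ψ =
                L + PowerSeries.C (PowerSeries.X - PowerSeries.C (toUnr p (x k))) * U) ∧
            (∃ e : ℕ, PowerSeries.C ((p : 𝓞_ℂ_[p]) ^ e) * PowerSeries.map (R1.unrToCpInt p) Ψ ∈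
              Ideal.span {PowerSeries.map (R1.unrToCpInt p) Lg})) ∧
        (∃ A : ℕ → UnrSeries p, ∀ ℓ : ℕ, ℓ.Prime → ¬ ℓ ∣ N →
          (∃ U : UnrSeries p, A ℓ = PowerSeries.C (toUnr p ((W.frobeniusTrace ℓ : ℤ) : ℤ_[p])) + PowerSeries.X * U) ∧
          ∀ k : ℕ, ∃ (c : unrIntegers p) (U : UnrSeries p),
            A ℓ = PowerSeries.C c + (PowerSeries.X - PowerSeries.C (toUnr p (x k))) * U ∧
            ((c : ℂ_[p]) = algebraMap (PadicAlgCl p) ℂ_[p]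
              ((D k).ι ⟨(UpperHalfPlane.qExpansion 1 ⇑(D k).g).coeff ℓ, coeff_mem_coeffField (D k).g ℓ⟩))) →
      ∃ F : PowerSeries (PowerSeries (unrIntegers p)),
        ¬ (PowerSeries.C (PowerSeries.X : PowerSeries (unrIntegers p)) ∣ F) ∧
        (∃ j : ℕ, PowerSeries.C ((p : 𝓞_ℂ_[p]) ^ j) *
            PowerSeries.map (R1.unrToCpInt p) (PowerSeries.map (PowerSeries.constantCoeff (R := unrIntegers p)) F) ∈
          (XAc.charIdeal (W.baseChange K) p κ 𝔭bar ∅ γ).map (PowerSeries.map (R1.toCpInt p))) ∧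
        ∀ k : ℕ, ∃ Φ : UnrSeries p,
          (∃ G U : PowerSeries (PowerSeries (unrIntegers p)),
            PowerSeries.map (PowerSeries.C (R := unrIntegers p)) Φ =
              F * G + PowerSeries.C (PowerSeries.X - PowerSeries.C (toUnr p (x k))) * U) ∧
          ∀ (b : padicCoeffIntegers (D k).ι →+* 𝓞_ℂ_[p]),
            (∀ y, ((b y : 𝓞_ℂ_[p]) : ℂ_[p]) =
              algebraMap (PadicAlgCl p) ℂ_[p] (padicCoeffIntegers.toPadicAlgCl (D k).ι y)) →
          ∀ [TopologicalSpace (PowerSeries (padicCoeffIntegers (D k).ι))]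
            [ContinuousSMul (PowerSeries (padicCoeffIntegers (D k).ι))
              (BigRepModule (padicCoeffIntegers (D k).ι) p (Cofree (D k).Δ.selfDualRep (padicCoeffField (D k).ι)))],
            ∃ j : ℕ, Ideal.span {PowerSeries.C ((p : 𝓞_ℂ_[p]) ^ j)} *
                (XBig.charIdeal κ ((D k).Δ.selfDualCofreeRepOver K) 𝔭bar
                  (∅ : Set (HeightOneSpectrum (𝓞 K)))).map (PowerSeries.map b) ≤
              Ideal.span {PowerSeries.map (R1.unrToCpInt p) Φ} :=
  carrierAlg_of_witness stub_carrierAlgW stub_herbrandTranslate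

#print axioms carrierAlg_of_witness
#print axioms stub_carrierAlg_of_K2split

end Summit.BirchSwinnertonDyer.BirchSwinnertonDyer.Cruxes.BSDpOnCellC.Telescope

end
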